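import Literature.Computability.Complexity.TVSelfCorrectMajority
import Literature.Computability.Complexity.TVLengthLemmas
import HarnessLib

/-!
# Self-correction of Trevisan–Vadhan's `F`: the parameter choice (IW98 Def. 5 with Def. 4's `1 − 1/a`)

Literature / complexity — derandomization (Case 2 of IW98 in TV07 form), sequel of
`TVSelfCorrectMajority.lean`. The counting theorems there (`card_badTrials_le`, `card_majCorrected_ne_le`)
carry free parameters — the pad threshold `T`, the number of lines `r`, the number of trials `s` — and
the hypothesis "at most a quarter of the trials are bad". This file fixes them once and for all, in the
shape a strong construction (IW98 Def. 4: success `≥ 1 − 1/a`, coins polynomial in `n + a`) consumes: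

* `QBFUniv.linesOf n = 32 (ptLen n + 3)` lines, `QBFUniv.trialsOf a = 8 a` trials, threshold
  `QBFUniv.thrOf n = |K|^{N n} / (4 (Dn n + 1))`;
* `QBFUniv.card_K_pow` (`|K n|^{N n} = 2^{ptLen n}`), `QBFUniv.exp_neg_linesOf_le`
  (`|K|^N · exp(−r/32) ≤ 1/8`);
* **`QBFUniv.four_mul_card_badTrials_le`** — if `g` errs on at most a
  `1 / (64 · blk n · (Dn n + 1)²)` fraction of `{0,1}^{h n i}` (precisely:
  `64 · blk n · (Dn n + 1)² · #Bad ≤ 2^{h n i}`), then at most a quarter of the trials are bad;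
* **`QBFUniv.card_majCorrected_ne_le_div`** — hence the `8a`-fold majority of corrected trials differs
  from `F` somewhere on `{0,1}^{h n i}` on at most a `1/a`-fraction of the coin tuples (`a ≥ 1`):
  the random self-reduction `C^{F, 1 − ρ} → C^F` of IW98 Def. 5 for `F` at every canonical length, with
  `ρ(h n i) = 1/(64 · blk n · (Dn n + 1)²)` (polynomial in the length), as pure counting.

Everything is proved; the three parameter definitions are plain (no named facts).

## References

* [ImpagliazzoWigderson2001] R. Impagliazzo, A. Wigderson, JCSS 63 (2001), §2.2 Defs. 4–5.
* [TrevisanVadhan2007] L. Trevisan, S. Vadhan, Comput. Complexity 16 (2007), Lemma 3.5, Thm. 4.3 (proof).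
-/

noncomputable section

namespace Literature.Computability.Complexity

namespace QBFUniv

open Finset Literature.InformationTheory.Coding PolySelfCorrect

open scoped Classical

variable {n i : ℕ}

/-! ### The parameters -/

/-- The number of lines per trial: `32 (ptLen n + 3)`. [cite: TrevisanVadhan2007, Lemma 3.5] -/
def linesOf (n : ℕ) : ℕ := 32 * (ptLen n + 3)

/-- The number of trials for success `1 − 1/a`: `8 a`. [cite: ImpagliazzoWigderson2001, Def. 4] -/
def trialsOf (a : ℕ) : ℕ := 8 * a

/-- The pad threshold: `|K|^{N n} / (4 (Dn n + 1))`. [folklore] -/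
def thrOf (n : ℕ) : ℕ := Fintype.card (K n) ^ N n / (4 * (Dn n + 1))

/-- `|K n|^{N n} = 2^{ptLen n}`. [folklore] -/
theorem card_K_pow (n : ℕ) : Fintype.card (K n) ^ N n = 2 ^ ptLen n := by
  rw [show Fintype.card (K n) = 2 ^ (Mof n + 1) from SelfCorrect.card_GF2 (Mof n), ← pow_mul, ptLen, blk, Nat.mul_comm]

/-- The threshold satisfies the hypothesis of `card_badDirs_le`. [folklore] -/
theorem thrOf_spec (n : ℕ) : 4 * ((Dn n + 1) * thrOf n) ≤ Fintype.card (K n) ^ N n := by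
  rw [thrOf, ← Nat.mul_assoc]; exact Nat.mul_div_le _ _

/-- The threshold is large: `|K|^N < (thrOf n + 1) · 4 (Dn n + 1)`. [folklore] -/
theorem lt_thrOf_succ_mul (n : ℕ) : Fintype.card (K n) ^ N n < (thrOf n + 1) * (4 * (Dn n + 1)) := by
  rw [thrOf, Nat.succ_mul]
  exact Nat.lt_div_mul_add (by positivity)

/-- **The lines make the line failure small**: `|K|^N · exp(−r/32) ≤ 1/8` for `r = linesOf n`. [folklore] -/
theorem exp_neg_linesOf_le (n : ℕ) :
    (Fintype.card (K n) : ℝ) ^ N n * Real.exp (-(linesOf n / 32 : ℝ)) ≤ 1 / 8 := by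
  have hK : ((Fintype.card (K n) : ℝ) ^ N n) = (2 : ℝ) ^ ptLen n := by exact_mod_cast card_K_pow n
  have hr : (linesOf n / 32 : ℝ) = (ptLen n + 3 : ℕ) := by
    rw [linesOf, Nat.cast_mul]; push_cast; ring
  rw [hK, hr, Real.exp_neg]
  have h2 : (2 : ℝ) ≤ Real.exp 1 := by have := Real.add_one_le_exp (1 : ℝ); norm_num at this ⊢; exact this
  have h3 : (2 : ℝ) ^ (ptLen n + 3) ≤ Real.exp ((ptLen n + 3 : ℕ) : ℝ) := by
    rw [← Real.exp_one_pow]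
    exact pow_le_pow_left₀ (by norm_num) h2 _
  have hpos : (0 : ℝ) < Real.exp ((ptLen n + 3 : ℕ) : ℝ) := Real.exp_pos _
  rw [← div_eq_mul_inv, div_le_iff₀ hpos]
  have e : (2 : ℝ) ^ (ptLen n + 3) = 8 * 2 ^ ptLen n := by rw [pow_add]; norm_num; ring
  linarith

/-- The cardinality of the trials. [folklore] -/
theorem card_Trial (n i r : ℕ) :
    (Fintype.card (Trial n i r) : ℝ) = (2 : ℝ) ^ padLen n i * (Fintype.card (K n) : ℝ) ^ (N n * r) := by
  simp [Trial, Fintype.card_prod, Fintype.card_fin, pow_mul]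

/-- **A quarter at most of the trials are bad** when `g` errs on at most a
`1/(64 · blk n · (Dn n + 1)²)` fraction of `{0,1}^{h n i}`. [cite: ImpagliazzoWigderson2001, Def. 5]
[cite: TrevisanVadhan2007, Lemma 3.5] -/
theorem four_mul_card_badTrials_le (hi : i ≤ mlen n) (g : List Bool → Bool) (Bad : Finset (List Bool))
    (hBad : ∀ w : List Bool, w.length = h n i → g w ≠ FB w → w ∈ Bad)
    (hρ : 64 * blk n * (Dn n + 1) ^ 2 * #Bad ≤ 2 ^ h n i) :
    4 * #(badTrials g n i (linesOf n)) ≤ Fintype.card (Trial n i (linesOf n)) := by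
  have hr : 0 < linesOf n := by rw [linesOf]; positivity
  have hb := card_badTrials_le hi g Bad hBad (thrOf_spec n) hr
  have hT := card_Trial n i (linesOf n)
  -- the line part
  have hB : (2 : ℝ) ^ padLen n i * ((Fintype.card (K n) : ℝ) ^ N n *
      (Real.exp (-(linesOf n / 32 : ℝ)) * ((Fintype.card (K n) : ℝ) ^ N n) ^ linesOf n)) ≤
      Fintype.card (Trial n i (linesOf n)) / 8 := by
    rw [hT, ← pow_mul]
    have h1 := exp_neg_linesOf_le n
    have hpos : (0 : ℝ) ≤ (2 : ℝ) ^ padLen n i * (Fintype.card (K n) : ℝ) ^ (N n * linesOf n) := by positivity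
    calc (2 : ℝ) ^ padLen n i * ((Fintype.card (K n) : ℝ) ^ N n *
          (Real.exp (-(linesOf n / 32 : ℝ)) * (Fintype.card (K n) : ℝ) ^ (N n * linesOf n)))
        = ((Fintype.card (K n) : ℝ) ^ N n * Real.exp (-(linesOf n / 32 : ℝ))) *
            ((2 : ℝ) ^ padLen n i * (Fintype.card (K n) : ℝ) ^ (N n * linesOf n)) := by ring
      _ ≤ 1 / 8 * ((2 : ℝ) ^ padLen n i * (Fintype.card (K n) : ℝ) ^ (N n * linesOf n)) :=
          mul_le_mul_of_nonneg_right h1 hpos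
      _ = _ := by ring
  -- the pad part: `8 · blk · #Bad ≤ (T+1) · 2^{padLen}`
  have hpad : 8 * blk n * #Bad ≤ (thrOf n + 1) * 2 ^ padLen n i := by
    -- multiply by `4 (Dn+1)` and compare with `2^{h} = 2^{ptLen} 2^{blk} 2^{padLen}`
    have h1 := lt_thrOf_succ_mul n
    rw [card_K_pow] at h1
    have h2 : 2 ^ blk n ≤ 2 * (Dn n + 1) := two_pow_Mof_succ_le n
    have hh : 2 ^ h n i = 2 ^ ptLen n * 2 ^ blk n * 2 ^ padLen n i := by
      rw [← pow_add, ← pow_add, ptLen_add]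
    refine Nat.le_of_mul_le_mul_right (c := 4 * (Dn n + 1)) ?_ (by positivity)
    have hpos : 0 < 2 ^ blk n := Nat.two_pow_pos _
    refine Nat.le_of_mul_le_mul_right (c := 2 ^ blk n) ?_ hpos
    calc 8 * blk n * #Bad * (4 * (Dn n + 1)) * 2 ^ blk n
        ≤ 8 * blk n * #Bad * (4 * (Dn n + 1)) * (2 * (Dn n + 1)) := Nat.mul_le_mul_left _ h2
      _ = 64 * blk n * (Dn n + 1) ^ 2 * #Bad := by ring
      _ ≤ 2 ^ h n i := hρ
      _ = 2 ^ ptLen n * 2 ^ blk n * 2 ^ padLen n i := hh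
      _ ≤ (thrOf n + 1) * (4 * (Dn n + 1)) * 2 ^ blk n * 2 ^ padLen n i :=
          Nat.mul_le_mul_right _ (Nat.mul_le_mul_right _ h1.le)
      _ = (thrOf n + 1) * 2 ^ padLen n i * (4 * (Dn n + 1)) * 2 ^ blk n := by ring
  have hA : (blk n * #Bad : ℝ) / (thrOf n + 1) * (Fintype.card (K n) : ℝ) ^ (N n * linesOf n) ≤
      Fintype.card (Trial n i (linesOf n)) / 8 := by
    rw [hT, div_mul_eq_mul_div, div_le_div_iff₀ (by positivity) (by norm_num)]
    have hpad' : (8 * blk n * #Bad : ℝ) ≤ (thrOf n + 1) * 2 ^ padLen n i := by exact_mod_cast hpad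
    have hpos : (0 : ℝ) ≤ (Fintype.card (K n) : ℝ) ^ (N n * linesOf n) := by positivity
    nlinarith
  have : (4 * #(badTrials g n i (linesOf n)) : ℝ) ≤ Fintype.card (Trial n i (linesOf n)) := by linarith
  exact_mod_cast this

/-- **The random self-reduction of `F` with success `1 − 1/a`**: with `8a` trials of `linesOf n` lines
each, the majority-corrected function differs from `F` somewhere on `{0,1}^{h n i}` on at most a
`1/a`-fraction of the coin tuples, provided `g` errs on at most a `1/(64 · blk n · (Dn n + 1)²)` fraction
of that length. [cite: ImpagliazzoWigderson2001, Defs. 4–5] [cite: TrevisanVadhan2007, Lemma 3.5] -/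
theorem card_majCorrected_ne_le_div (hi : i ≤ mlen n) (g : List Bool → Bool) (Bad : Finset (List Bool))
    (hBad : ∀ w : List Bool, w.length = h n i → g w ≠ FB w → w ∈ Bad)
    (hρ : 64 * blk n * (Dn n + 1) ^ 2 * #Bad ≤ 2 ^ h n i) {a : ℕ} (ha : 1 ≤ a) :
    (#(univ.filter fun cs : Fin (trialsOf a) → Trial n i (linesOf n) =>
        ∃ w : List Bool, w.length = h n i ∧ majCorrected g n cs w ≠ FB w) : ℝ) ≤
      Fintype.card (Fin (trialsOf a) → Trial n i (linesOf n)) / a := by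
  have hs : 0 < trialsOf a := by rw [trialsOf]; omega
  have h1 := card_majCorrected_ne_le hi g hs (four_mul_card_badTrials_le hi g Bad hBad hρ)
  refine h1.trans ?_
  have hexp : Real.exp (-(trialsOf a / 8 : ℝ)) ≤ 1 / a := by
    have e : (trialsOf a / 8 : ℝ) = a := by rw [trialsOf, Nat.cast_mul]; push_cast; ring
    rw [e, Real.exp_neg, one_div]
    have ha' : (0 : ℝ) < a := by exact_mod_cast ha
    exact inv_anti₀ ha' ((le_add_of_nonneg_right zero_le_one).trans (Real.add_one_le_exp _))
  calc Real.exp (-(trialsOf a / 8 : ℝ)) * Fintype.card (Fin (trialsOf a) → Trial n i (linesOf n))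
      ≤ 1 / a * Fintype.card (Fin (trialsOf a) → Trial n i (linesOf n)) := mul_le_mul_of_nonneg_right hexp (by positivity)
    _ = _ := by ring

end QBFUniv

end Literature.Computability.Complexity

end
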